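import Mathlib
import Summits.Ventures.LatticeQCDFlow.Scaling.TorusPlaquetteGeometry

/-!
# LatticeQCDFlow / Scaling — the unit cube between two stacked plaquettes on the torus:
# its lateral faces, and which genuine plaquettes touch both stacked plaquettes

HONEST FRAMING: exact (Metropolis-corrected) sampling algorithms for lattice gauge theory;
figures of merit are autocorrelation/cost numbers at stated couplings and volumes; no
continuum-physics claim.

Venture `LatticeQCDFlow` (cell pub-lqcd), topic `Scaling`, FANOUT row 30 (lean-1) — OUR WORK, the
second combinatorial input of the leading-coefficient identity (LC) of theory2 item 120
(HOME/lean/theory2/LANDING.md §32), on the torus `(ℤ/L)^d`, `L ≥ 3`, `d ≥ 3`: the two stacked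
genuine plaquettes `top i j = (0, i, j)` and `bot i j a = (−e_a, i, j)` (`i ≠ j`, `a ∉ {i, j}`)
and the four LATERAL FACES `lat… ` of the unit cube between them (sorted labels of the plaquettes
based at `−e_a`, `−e_a + e_j` in the `{i, a}` planes and at `−e_a`, `−e_a + e_i` in the `{j, a}`
planes).

* `tbonds_swap`, `srt` — bond sets do not depend on the orientation of a label; the sorted label.
* `apply_a_of_mem_tbonds_top` / `_bot` — bonds of `top` sit at height `0`, bonds of `bot` at height
  `−1` in the `a`-direction, neither has direction `a`.
* **`mem_lat_of_touches`** — a genuine label other than `top`, `bot` that shares a bond with `top`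
  AND a bond with `bot` is one of the four lateral faces (height bookkeeping in `ℤ/L`, `L ≥ 3`).
* `top_ne_bot`, `disjoint_tbonds_top_bot`; `latVec` — the lateral faces as a `Fin 4`-vector: genuine
  (`latVec_genuine`), pairwise distinct (`latVec_injective`), different from `top`, `bot`.
Elementary; nothing is cited as a fact; eight `def`s (labels only: `srt`, `top`, `bot`, `latI`, `latI'`,
`latJ`, `latJ'`, `latVec`), no `sorry`.
-/

namespace Summit.Ventures.LatticeQCDFlow.Theory2.Lattice.TorusGeom

open Literature.MathematicalPhysics.QuantumFieldTheory
open Literature.MathematicalPhysics.QuantumLattice (zmod_one_ne_zero_of_two_le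
  zmod_one_add_one_ne_zero_of_three_le)

variable {d L : ℕ}

/-! ## §1. Orientation, sorted labels -/

/-- The bond set of a label does not depend on the order of its two directions. [folklore] -/
theorem tbonds_swap (y : Site d L) (m n : Fin d) :
    TPlaq.tbonds ((y, n, m) : TPlaq d L) = TPlaq.tbonds ((y, m, n) : TPlaq d L) := by
  ext b
  simp only [mem_tbonds_iff]
  tauto

/-- The sorted (genuine) label of the plaquette at `y` in the `{m, n}` plane. [folklore] -/
def srt (y : Site d L) (m n : Fin d) : TPlaq d L := if m < n then (y, m, n) else (y, n, m)

/-- The sorted label is genuine for `m ≠ n`. [folklore] -/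
theorem srt_genuine (y : Site d L) {m n : Fin d} (h : m ≠ n) : (srt y m n).2.1 < (srt y m n).2.2 := by
  unfold srt
  split_ifs with hmn
  · exact hmn
  · exact lt_of_le_of_ne (not_lt.1 hmn) (Ne.symm h)

/-- The bonds of the sorted label are those of the unsorted one. [folklore] -/
theorem tbonds_srt (y : Site d L) (m n : Fin d) :
    (srt y m n).tbonds = TPlaq.tbonds ((y, m, n) : TPlaq d L) := by
  unfold srt
  split_ifs
  · rfl
  · exact tbonds_swap y m n

/-- The base point of the sorted label. [folklore] -/
@[simp] theorem srt_fst (y : Site d L) (m n : Fin d) : (srt y m n).1 = y := by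
  unfold srt; split_ifs <;> rfl

/-- The direction `n` belongs to the sorted label `srt y m n`. [folklore] -/
theorem srt_dir_mem (y : Site d L) (m n : Fin d) : (srt y m n).2.1 = n ∨ (srt y m n).2.2 = n := by
  unfold srt; split_ifs <;> simp

/-! ## §2. The two stacked plaquettes and the lateral faces -/

/-- The upper plaquette `(0; i, j)`. [folklore] -/
def top (i j : Fin d) : TPlaq d L := (0, i, j)

/-- The lower plaquette `(−e_a; i, j)`. [folklore] -/
def bot (i j a : Fin d) : TPlaq d L := (-Pi.single a 1, i, j)

/-- Lateral face in the `{i, a}` plane through the bond `(0, i)` of `top`. [folklore] -/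
def latI (i a : Fin d) : TPlaq d L := srt (-Pi.single a 1) i a

/-- Lateral face in the `{i, a}` plane through the bond `(e_j, i)` of `top`. [folklore] -/
def latI' (i j a : Fin d) : TPlaq d L := srt (-Pi.single a 1 + Pi.single j 1) i a

/-- Lateral face in the `{j, a}` plane through the bond `(0, j)` of `top`. [folklore] -/
def latJ (j a : Fin d) : TPlaq d L := srt (-Pi.single a 1) j a

/-- Lateral face in the `{j, a}` plane through the bond `(e_i, j)` of `top`. [folklore] -/
def latJ' (i j a : Fin d) : TPlaq d L := srt (-Pi.single a 1 + Pi.single i 1) j a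

section Cube

variable {i j a : Fin d}

/-- `0 ≠ -1` in `ℤ/L`, `L ≥ 2`. [folklore] -/
theorem zero_ne_neg_one (hL : 2 ≤ L) : (0 : ZMod L) ≠ -1 := fun h =>
  zmod_one_ne_zero_of_two_le hL (neg_eq_zero.1 h.symm)

/-- Bonds of `top` sit at `a`-height `0` and do not point in direction `a`. [folklore] -/
theorem apply_a_of_mem_tbonds_top (hai : a ≠ i) (haj : a ≠ j) {b : Edge d L}
    (hb : b ∈ (top i j : TPlaq d L).tbonds) : b.1 a = 0 ∧ b.2 ≠ a := by
  obtain ⟨s, m⟩ := b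
  simp only [top, mem_tbonds_iff, Prod.mk.injEq] at hb
  rcases hb with ⟨rfl, rfl⟩ | ⟨rfl, rfl⟩ | ⟨rfl, rfl⟩ | ⟨rfl, rfl⟩ <;>
    simp [hai, haj, Ne.symm hai, Ne.symm haj]

/-- Bonds of `bot` sit at `a`-height `−1` and do not point in direction `a`. [folklore] -/
theorem apply_a_of_mem_tbonds_bot (hai : a ≠ i) (haj : a ≠ j) {b : Edge d L}
    (hb : b ∈ (bot i j a : TPlaq d L).tbonds) : b.1 a = -1 ∧ b.2 ≠ a := by
  obtain ⟨s, m⟩ := b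
  simp only [bot, mem_tbonds_iff, Prod.mk.injEq] at hb
  rcases hb with ⟨rfl, rfl⟩ | ⟨rfl, rfl⟩ | ⟨rfl, rfl⟩ | ⟨rfl, rfl⟩ <;>
    simp [hai, haj, Ne.symm hai, Ne.symm haj]

/-- `top ≠ bot`. [folklore] -/
theorem top_ne_bot (hL : 2 ≤ L) : (top i j : TPlaq d L) ≠ bot i j a := by
  intro h
  have := congr_arg Prod.fst h
  simp only [top, bot] at this
  exact single_ne_zero hL a (neg_eq_zero.1 this.symm)

/-- `top` and `bot` have no bond in common. [folklore] -/
theorem disjoint_tbonds_top_bot (hL : 2 ≤ L) (hai : a ≠ i) (haj : a ≠ j) :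
    Disjoint (top i j : TPlaq d L).tbonds (bot i j a : TPlaq d L).tbonds := by
  rw [Finset.disjoint_left]
  intro b hbT hbB
  have h0 := (apply_a_of_mem_tbonds_top hai haj hbT).1
  have h1 := (apply_a_of_mem_tbonds_bot hai haj hbB).1
  rw [h0] at h1
  exact zero_ne_neg_one hL h1

/-- The `a`-coordinate of a bond site of `(y, k, l)` when `a ∉ {k, l}` is that of `y`. [folklore] -/
theorem apply_a_of_mem_tbonds_of_ne {y : Site d L} {k l : Fin d} (hak : a ≠ k) (hal : a ≠ l)
    {b : Edge d L} (hb : b ∈ TPlaq.tbonds ((y, k, l) : TPlaq d L)) : b.1 a = y a := by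
  obtain ⟨s, m⟩ := b
  simp only [mem_tbonds_iff, Prod.mk.injEq] at hb
  rcases hb with ⟨rfl, -⟩ | ⟨rfl, -⟩ | ⟨rfl, -⟩ | ⟨rfl, -⟩ <;> simp [hak, hal]

/-- **A genuine plaquette other than `top`, `bot` touching both is a lateral face.** [folklore] -/
theorem mem_lat_of_touches (hL : 3 ≤ L) (hai : a ≠ i) (haj : a ≠ j) {q : TPlaq d L}
    (hq : q.2.1 < q.2.2)
    {b : Edge d L} (hbq : b ∈ q.tbonds) (hbT : b ∈ (top i j : TPlaq d L).tbonds)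
    {b' : Edge d L} (hb'q : b' ∈ q.tbonds) (hb'B : b' ∈ (bot i j a : TPlaq d L).tbonds) :
    q = latI i a ∨ q = latI' i j a ∨ q = latJ j a ∨ q = latJ' i j a := by
  have hL2 : 2 ≤ L := by omega
  obtain ⟨y, k, l⟩ := q
  simp only at hq
  have hkl : k ≠ l := Fin.ne_of_lt hq
  obtain ⟨hT0, hTdir⟩ := apply_a_of_mem_tbonds_top hai haj hbT
  obtain ⟨hB0, hBdir⟩ := apply_a_of_mem_tbonds_bot hai haj hb'B
  -- the plane of `q` contains the direction `a`
  have haKL : a = k ∨ a = l := by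
    by_contra h
    push Not at h
    have e1 := apply_a_of_mem_tbonds_of_ne h.1 h.2 hbq
    have e2 := apply_a_of_mem_tbonds_of_ne h.1 h.2 hb'q
    rw [hT0] at e1
    rw [hB0, ← e1] at e2
    exact zero_ne_neg_one hL2 e2.symm
  -- the shared bonds point in the other direction `m` of `q` and sit at `y` / `y + e_a`
  obtain ⟨s, m⟩ := b
  obtain ⟨s', m'⟩ := b'
  simp only at hT0 hTdir hB0 hBdir
  -- sites of the shared bonds: `s = y + e_a` and `s' = y`
  have hsites : ∀ {t : Site d L} {n : Fin d}, ((t, n) : Edge d L) ∈ TPlaq.tbonds ((y, k, l) : TPlaq d L) →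
      n ≠ a → (t = y ∨ t = y + Pi.single a 1) := by
    intro t n ht hn
    rcases haKL with rfl | rfl
    · -- a = k: the `l`-bonds sit at `y + e_a` and `y`
      rcases dir_of_mem_tbonds ht with rfl | rfl
      · exact absurd rfl hn
      · rcases site_of_mem_tbonds_snd hkl ht with h | h
        · exact Or.inr h
        · exact Or.inl h
    · -- a = l: the `k`-bonds sit at `y` and `y + e_a`
      rcases dir_of_mem_tbonds ht with rfl | rfl
      · exact site_of_mem_tbonds_fst hkl ht
      · exact absurd rfl hn
  have hs : s = y + Pi.single a 1 := by
    rcases hsites hbq hTdir with hsy | h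
    · -- s = y: then `y a = 0`, and the `bot` bond forces `y a = -1` or `y a + 1 = -1`
      exfalso
      rw [hsy] at hT0
      rcases hsites hb'q hBdir with h' | h'
      · rw [h', hT0] at hB0
        exact zero_ne_neg_one hL2 hB0
      · rw [h'] at hB0
        simp only [Pi.add_apply, Pi.single_eq_same, hT0, zero_add] at hB0
        exact zmod_one_add_one_ne_zero_of_three_le hL
          (by calc (1 : ZMod L) + 1 = 1 + (-1) := by rw [← hB0]
                _ = 0 := by ring)
    · exact h
  have hs' : s' = y := by
    rcases hsites hb'q hBdir with h | h
    · exact h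
    · exfalso
      rw [hs] at hT0
      rw [h] at hB0
      simp only [Pi.add_apply, Pi.single_eq_same] at hT0 hB0
      rw [hT0] at hB0
      exact zero_ne_neg_one hL2 hB0
  subst hs
  -- now read off `y` and the plane from the `top` bond `(y + e_a, m)`
  simp only [top, mem_tbonds_iff, Prod.mk.injEq, zero_add] at hbT
  have hdir := dir_of_mem_tbonds hbq
  rcases hbT with ⟨hy, rfl⟩ | ⟨hy, rfl⟩ | ⟨hy, rfl⟩ | ⟨hy, rfl⟩
  · -- (0, i): y = -e_a, plane {i, a}
    have hy' : y = -Pi.single a 1 := eq_neg_of_add_eq_zero_left hy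
    subst hy'
    left
    unfold latI srt
    rcases haKL with rfl | rfl <;> rcases hdir with h | h
    · exact absurd h.symm hai
    · subst h; simp [not_lt.2 (le_of_lt hq)]
    · subst h; simp [hq]
    · exact absurd h.symm hai
  · -- (e_i, j): y = -e_a + e_i, plane {j, a}
    have hy' : y = -Pi.single a 1 + Pi.single i 1 := by
      rw [← hy]; abel
    subst hy'
    right; right; right
    unfold latJ' srt
    rcases haKL with rfl | rfl <;> rcases hdir with h | h
    · exact absurd h.symm haj
    · subst h; simp [not_lt.2 (le_of_lt hq)]
    · subst h; simp [hq]
    · exact absurd h.symm haj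
  · -- (e_j, i): y = -e_a + e_j, plane {i, a}
    have hy' : y = -Pi.single a 1 + Pi.single j 1 := by
      rw [← hy]; abel
    subst hy'
    right; left
    unfold latI' srt
    rcases haKL with rfl | rfl <;> rcases hdir with h | h
    · exact absurd h.symm hai
    · subst h; simp [not_lt.2 (le_of_lt hq)]
    · subst h; simp [hq]
    · exact absurd h.symm hai
  · -- (0, j): y = -e_a, plane {j, a}
    have hy' : y = -Pi.single a 1 := eq_neg_of_add_eq_zero_left hy
    subst hy'
    right; right; left
    unfold latJ srt
    rcases haKL with rfl | rfl <;> rcases hdir with h | h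
    · exact absurd h.symm haj
    · subst h; simp [not_lt.2 (le_of_lt hq)]
    · subst h; simp [hq]
    · exact absurd h.symm haj

/-! ## §3. The lateral faces as an enumeration -/

/-- The four lateral faces as a vector. [folklore] -/
def latVec (i j a : Fin d) (n : Fin 4) : TPlaq d L :=
  match n with
  | ⟨0, _⟩ => latI i a
  | ⟨1, _⟩ => latI' i j a
  | ⟨2, _⟩ => latJ j a
  | ⟨_, _⟩ => latJ' i j a

/-- The disjunction "is a lateral face" as membership in the range of `latVec`. [folklore] -/
theorem exists_latVec_eq_of_or {q : TPlaq d L}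
    (h : q = latI i a ∨ q = latI' i j a ∨ q = latJ j a ∨ q = latJ' i j a) :
    ∃ n : Fin 4, q = latVec (L := L) i j a n := by
  rcases h with rfl | rfl | rfl | rfl
  · exact ⟨⟨0, by omega⟩, rfl⟩
  · exact ⟨⟨1, by omega⟩, rfl⟩
  · exact ⟨⟨2, by omega⟩, rfl⟩
  · exact ⟨⟨3, by omega⟩, rfl⟩

/-- Every lateral face is a genuine label. [folklore] -/
theorem latVec_genuine (hai : a ≠ i) (haj : a ≠ j) (n : Fin 4) :
    (latVec (L := L) i j a n).2.1 < (latVec (L := L) i j a n).2.2 := by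
  match n with
  | ⟨0, _⟩ => exact srt_genuine _ (Ne.symm hai)
  | ⟨1, _⟩ => exact srt_genuine _ (Ne.symm hai)
  | ⟨2, _⟩ => exact srt_genuine _ (Ne.symm haj)
  | ⟨3, _⟩ => exact srt_genuine _ (Ne.symm haj)

/-- The direction `a` belongs to every lateral face. [folklore] -/
theorem latVec_dir_mem (n : Fin 4) :
    (latVec (L := L) i j a n).2.1 = a ∨ (latVec (L := L) i j a n).2.2 = a := by
  match n with
  | ⟨0, _⟩ => exact srt_dir_mem _ _ _
  | ⟨1, _⟩ => exact srt_dir_mem _ _ _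
  | ⟨2, _⟩ => exact srt_dir_mem _ _ _
  | ⟨3, _⟩ => exact srt_dir_mem _ _ _

/-- No lateral face is `top`. [folklore] -/
theorem latVec_ne_top (hai : a ≠ i) (haj : a ≠ j) (n : Fin 4) :
    latVec (L := L) i j a n ≠ top i j := by
  intro h
  rcases latVec_dir_mem (i := i) (j := j) (a := a) (L := L) n with h' | h' <;>
    rw [h] at h' <;> simp only [top] at h'
  · exact hai h'.symm
  · exact haj h'.symm

/-- No lateral face is `bot`. [folklore] -/
theorem latVec_ne_bot (hai : a ≠ i) (haj : a ≠ j) (n : Fin 4) :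
    latVec (L := L) i j a n ≠ bot i j a := by
  intro h
  rcases latVec_dir_mem (i := i) (j := j) (a := a) (L := L) n with h' | h' <;>
    rw [h] at h' <;> simp only [bot] at h'
  · exact hai h'.symm
  · exact haj h'.symm

/-- Sorted labels with a common direction `n` and equal values have equal other directions. [folklore] -/
theorem srt_eq_srt_dir {y y' : Site d L} {m m' n : Fin d} (hm : m ≠ n)
    (h : srt y m n = srt y' m' n) : m = m' := by
  unfold srt at h
  split_ifs at h with h1 h2 h2 <;> simp only [Prod.mk.injEq] at h
  · exact h.2.1
  · exact absurd h.2.1 hm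
  · exact absurd h.2.2 hm
  · exact h.2.2

/-- **The lateral faces are pairwise distinct.** [folklore] -/
theorem latVec_injective (hL : 2 ≤ L) (hij : i ≠ j) (hai : a ≠ i) :
    Function.Injective (latVec i j a : Fin 4 → TPlaq d L) := by
  have hb1 : (-Pi.single a 1 : Site d L) ≠ -Pi.single a 1 + Pi.single j 1 :=
    fun h => add_single_ne_self hL _ j h.symm
  have hb2 : (-Pi.single a 1 : Site d L) ≠ -Pi.single a 1 + Pi.single i 1 :=
    fun h => add_single_ne_self hL _ i h.symm
  have hb3 : (-Pi.single a 1 + Pi.single j 1 : Site d L) ≠ -Pi.single a 1 + Pi.single i 1 :=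
    fun h => hij (eq_of_add_single_eq hL h).symm
  have hIJ : (latI i a : TPlaq d L) ≠ latJ j a :=
    fun h => hij (srt_eq_srt_dir (Ne.symm hai) h)
  have hI'J' : (latI' i j a : TPlaq d L) ≠ latJ' i j a := fun h => hb3 (by
    have := congr_arg Prod.fst h; simpa only [latI', latJ', srt_fst] using this)
  have hII' : (latI i a : TPlaq d L) ≠ latI' i j a := fun h => hb1 (by
    have := congr_arg Prod.fst h; simpa only [latI, latI', srt_fst] using this)
  have hIJ' : (latI i a : TPlaq d L) ≠ latJ' i j a := fun h => hb2 (by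
    have := congr_arg Prod.fst h; simpa only [latI, latJ', srt_fst] using this)
  have hI'J : (latI' i j a : TPlaq d L) ≠ latJ j a := fun h => hb1 (by
    have := congr_arg Prod.fst h; simpa only [latI', latJ, srt_fst] using this.symm)
  have hJJ' : (latJ j a : TPlaq d L) ≠ latJ' i j a := fun h => hb2 (by
    have := congr_arg Prod.fst h; simpa only [latJ, latJ', srt_fst] using this)
  intro n n' h
  match n, n' with
  | ⟨0, _⟩, ⟨0, _⟩ => rfl
  | ⟨1, _⟩, ⟨1, _⟩ => rfl
  | ⟨2, _⟩, ⟨2, _⟩ => rfl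
  | ⟨3, _⟩, ⟨3, _⟩ => rfl
  | ⟨0, _⟩, ⟨1, _⟩ => exact absurd h hII'
  | ⟨0, _⟩, ⟨2, _⟩ => exact absurd h hIJ
  | ⟨0, _⟩, ⟨3, _⟩ => exact absurd h hIJ'
  | ⟨1, _⟩, ⟨0, _⟩ => exact absurd h.symm hII'
  | ⟨1, _⟩, ⟨2, _⟩ => exact absurd h hI'J
  | ⟨1, _⟩, ⟨3, _⟩ => exact absurd h hI'J'
  | ⟨2, _⟩, ⟨0, _⟩ => exact absurd h.symm hIJ
  | ⟨2, _⟩, ⟨1, _⟩ => exact absurd h.symm hI'J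
  | ⟨2, _⟩, ⟨3, _⟩ => exact absurd h hJJ'
  | ⟨3, _⟩, ⟨0, _⟩ => exact absurd h.symm hIJ'
  | ⟨3, _⟩, ⟨1, _⟩ => exact absurd h.symm hI'J'
  | ⟨3, _⟩, ⟨2, _⟩ => exact absurd h.symm hJJ'


end Cube

end Summit.Ventures.LatticeQCDFlow.Theory2.Lattice.TorusGeom
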